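import Summits.BirchSwinnertonDyer.BirchSwinnertonDyer.Theorems.UniversalToricDescentBigRepBoundedInvariantsCurve
import Summits.BirchSwinnertonDyer.BirchSwinnertonDyer.Theorems.ErratumRoadFiveLocalTorsionDegreeOne
import Summits.BirchSwinnertonDyer.BirchSwinnertonDyer.Theorems.UniversalToricDescentTwinDecLocusTateCube
import HarnessLib

/-!
# Route `UniversalToricDescent`, crux ♭B_T `TwinWanFrameAtThreeMultT` (stmt-BirchSwinnertonDyer-27172; registries 26062 / 20694),
# line `membertower` v6, research stub `stub_wanFrameMultCube` — cube-locus port step (P1) COMPLETE in the TWIN'S currency: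
# the E-side local input of THEOREM T♭ at the strict place `𝔭′` for the 3-multiplicative CUBE twin, in both coefficient
# currencies (`ℤ₃`: bsd-stepL's `tFlat_fLocal_branchT` at `p = 3`; `𝒪 ⊗ W′[3^∞]`: this seat's (P1b) over bsd-stepL's (O2′))

Cell `bsd-wall` (run/shared/lean/pub/bsd-wall/), width seat `bsd-wall-utd-p2-w2` (prover g3, 2026-08-28);
`--supports stmt-BirchSwinnertonDyer-20694 --as helper`; Theses-free. Memo `Cruxes/TwinSplitIMCAtThreeMult/CUBE-LOCUS-PORT-MAP-w2g3.md`.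

## Context (numbers, not adjectives)

On the cube locus (a Tate datum `D` of `W′` at 3 with `q = u³`; ⟺ `E(ℚ₃)[3] ≠ 0` for the cell curve, p620281) the descent's binder
(dec) fails and the member congruence must run with a DEFECT; bsd-stepL's THEOREM T♭ (crux 19702, seat bsd-stepL-bdp g13–g16) is
that road, p-generic, and its E-side local input at the strict place is `LocalTorsionDegreeOne.tFlat_fLocal_branchT` (binders
`3 ≤ p`, `Mult W p`, a non-zero `p`-torsion point of `E(ℚ_p)`, `p` split in `K`, `κ` anticyclotomic). This file instantiates it
at the twin:

* §1 `twin_cube_exists_threeTorsion_point` — a cube Tate datum gives a NON-ZERO 3-torsion point of `W′(ℚ₃)` (w2 g2's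
  `twin_not_dec_of_cube`, p612881) and `SplitsIn K 3` from the Heegner hypothesis at a 3-multiplicative conductor.
* §2 **`twin_cube_tFlat_fLocal`** — `ℤ₃`-coefficients: for the cube twin under ♭B_T's binders, at EVERY `𝔭′ ∋ 3` of `K`,
  `H⁰(K_𝔭′, M_{W′}) = ((W′_K.anticyclotomicBigRep 3 κ)|_{localMap K (inl 𝔭′)})^{G_{K_𝔭′}}` is FINITE, bounded, and killed by
  `(C 3)^k` — verbatim the `[Finite …]` ∕ `hBf` ∕ `hkillf` inputs of
  `SelmerDefectAssemblyMixed.charIdeal_le_of_selmer_congruences_fLocal_printed_mixed` /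
  `LocalInvariantsTransfer.charIdeal_le_of_selmer_congruences_fLocal_printed`.
* §3 **`twin_cube_boundedInvariants_extendScalars`** — `𝒪 ⊗ W′[3^∞]`-coefficients (`𝒪` free over `ℤ₃`, the member's coefficient
  ring as in LEAD g11's port): the invariants of `(AnticyclotomicBigGaloisRep κ (extendScalars 𝒪 (W′_K.primaryTorsionGaloisRep 3)))
  |_{localMap K (inl 𝔭′)}` are killed by `(C 3)^k` — this seat's `boundedInvariants_extendScalars_localMap_inl` (p622903) fed by
  bsd-stepL's (O2′) `LocalTorsionDegreeOne.exists_pow_smul_eq_zero_and_finite_of_fixed` through `ℚ₃ ≃+* K_𝔭′`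
  (`nonempty_padic_ringEquiv_adicCompletion`) and the open local image of the anticyclotomic character
  (`AnticyclotomicLocalImage.anticyclotomic_exists_forall_exists_toAdd_eq_pow_mul`).

So step (P1) of the port is COMPLETE; what remains is (P2) wiring T♭'s Selmer-level kernel to the RoadFFMember objects at
`p = 3` (as g11 wired the exact `nonempty_memberCongruence`) and (P3) the rational descent with the slack `3^{kn}` joining `e`.
HONEST FRAMING: theorems only (no definition, no named fact, no `sorry`); unconditional; closes nothing; BSD is not proved.
References: [Castella2018Erratum] Lemma 2.1, Remark (2); [SilvermanATAEC1994] Thm. V.3.1 (d), V.5.3; [Brink2007] Cor. 1.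
-/

noncomputable section

open scoped Classical
open PowerSeries Field WeierstrassCurve NumberField IsDedekindDomain
  Literature.NumberTheory.GaloisRepresentations Literature.NumberTheory.EllipticCurves
  Literature.NumberTheory.EllipticCurves.Rank1Residual Literature.NumberTheory.EllipticCurves.BigRepModule
  Literature.NumberTheory.EllipticCurves.BigGaloisRep
  Summit.BirchSwinnertonDyer.Rank1Residual.X11b
  Summit.BirchSwinnertonDyer.BirchSwinnertonDyer.Theorems.UniversalToricDescentTwinDecLocus
  Summit.BirchSwinnertonDyer.BirchSwinnertonDyer.Theorems.UniversalToricDescentBigRepBoundedInvariantsCurve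
  Summit.BirchSwinnertonDyer.BirchSwinnertonDyer.Theorems.LocalTorsionDegreeOne

set_option linter.dupNamespace false
set_option autoImplicit false

namespace Summit.BirchSwinnertonDyer.BirchSwinnertonDyer.Theorems.UniversalToricDescentTwinCubeLocalInvariants

variable (W' : WeierstrassCurve ℚ) [W'.IsElliptic] [W'.IsGloballyMinimal] (N' : ℕ)
  {K : Type} [Field K] [NumberField K]

/-! ### §1 The cube twin carries a non-zero 3-torsion point over `ℚ₃`; 3 splits in `K` -/

omit [W'.IsGloballyMinimal] in
/-- A Tate datum with `q = u³` gives a NON-ZERO point `P ∈ W′(ℚ₃)` with `3P = O` (w2 g2's `twin_not_dec_of_cube`, p612881).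
[cite: SilvermanATAEC1994, Thm. V.3.1 (d) and Thm. V.5.3] -/
theorem twin_cube_exists_threeTorsion_point (D : TateParameterData W' 3) {u : ℚ_[3]} (hu : u ^ 3 = D.q) :
    ∃ P : (W'.baseChange ℚ_[3]).toAffine.Point, 3 • P = 0 ∧ P ≠ 0 := by
  have h := twin_not_dec_of_cube W' D ⟨u, hu⟩
  push Not at h
  obtain ⟨P, hP3, hP0⟩ := h
  exact ⟨P, hP3, hP0⟩

omit [W'.IsGloballyMinimal] [NumberField K] in
/-- Under the Heegner hypothesis for the conductor of a 3-multiplicative curve, 3 splits in `K`. [folklore] -/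
theorem twin_splitsIn_three (hm : Mult W' 3) (hN : W'.conductorNorm ℤ = N') (hH : SatisfiesHeegnerHypothesis N' K) :
    SplitsIn K 3 :=
  hH 3 Nat.prime_three (hN ▸ dvd_conductorNorm_of_mult hm)

/-! ### §2 `ℤ₃`-coefficients: bsd-stepL's `tFlat_fLocal_branchT` at the cube twin -/

/-- **T♭'s E-side local input at the strict place for the CUBE twin, `ℤ₃`-coefficients.** Under ♭B_T's binders (`Mult W′ 3`,
conductor `N′`, `K` imaginary quadratic with `SatisfiesHeegnerHypothesis N′ K`, `κ` anticyclotomic) and a cube Tate datum, at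
every prime `𝔭′ ∋ 3` of `K`: `H⁰(K_𝔭′, M_{W′})` (the invariants of `(W′_K.anticyclotomicBigRep 3 κ)|_{localMap K (inl 𝔭′)}`) is
FINITE, of bounded order, and killed by `(C 3)^k` for some `k` — verbatim the three `f`-side local hypotheses of
`SelmerDefectAssemblyMixed.charIdeal_le_of_selmer_congruences_fLocal_printed_mixed`. One line over bsd-stepL's
`LocalTorsionDegreeOne.tFlat_fLocal_branchT` (p-generic, `3 ≤ p`). [cite: Castella2018Erratum, Lemma 2.1 and Remark (2) (p. 2)]
[cite: SilvermanATAEC1994, Thm. V.5.3] -/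
theorem twin_cube_tFlat_fLocal (hm : Mult W' 3) (hN : W'.conductorNorm ℤ = N') (hK : IsImaginaryQuadratic K)
    (hH : SatisfiesHeegnerHypothesis N' K) (κ : ZpExtension K 3) (hκ : κ.IsAnticyclotomic)
    (D : TateParameterData W' 3) {u : ℚ_[3]} (hu : u ^ 3 = D.q)
    (𝔭' : HeightOneSpectrum (𝓞 K)) (h𝔭' : ((3 : ℕ) : 𝓞 K) ∈ 𝔭'.asIdeal)
    [TopologicalSpace (PowerSeries ℤ_[3])]
    [ContinuousSMul (PowerSeries ℤ_[3]) (BigRepModule ℤ_[3] 3 (PrimaryTorsion (geomPoints (W'.baseChange K)) 3))] :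
    ∃ k B : ℕ,
      Finite (((((W'.baseChange K).anticyclotomicBigRep 3 κ).restrict
        (BigGaloisRep.localMap K (Sum.inl 𝔭'))).toTopRep).ρ.invariants) ∧
      Nat.card (((((W'.baseChange K).anticyclotomicBigRep 3 κ).restrict
        (BigGaloisRep.localMap K (Sum.inl 𝔭'))).toTopRep).ρ.invariants) ≤ B ∧
      ∀ Φ ∈ ((((W'.baseChange K).anticyclotomicBigRep 3 κ).restrict
        (BigGaloisRep.localMap K (Sum.inl 𝔭'))).toTopRep).ρ.invariants,
        (PowerSeries.C (3 : ℤ_[3]) : PowerSeries ℤ_[3]) ^ k • Φ = 0 := by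
  haveI : Fact (Nat.Prime 3) := ⟨Nat.prime_three⟩
  have h := tFlat_fLocal_branchT W' 3 hK le_rfl hm (twin_cube_exists_threeTorsion_point W' D hu)
    (twin_splitsIn_three W' N' hm hN hH) 𝔭' h𝔭' κ hκ
  simpa using h

/-! ### §3 `𝒪 ⊗ W′[3^∞]`-coefficients: the member's coefficient ring -/

omit [W'.IsGloballyMinimal] in
/-- **T♭'s E-side local input at the strict place for the CUBE twin, coefficient module `𝒪 ⊗ W′[3^∞]`** (`𝒪` free over `ℤ₃`,
the Hida member's coefficient ring as in LEAD g11's port of the member congruence): under the same binders, at every `𝔭′ ∋ 3`,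
every `G_{K_𝔭′}`-invariant of `(AnticyclotomicBigGaloisRep κ (extendScalars 𝒪 (W′_K.primaryTorsionGaloisRep 3)))|_{localMap K (inl 𝔭′)}`
is killed by `(C 3)^k` for some `k` (stated for ANY twin with a Tate datum at 3, i.e. split multiplicative — on the cube locus this is
where it is needed) — this seat's `boundedInvariants_extendScalars_localMap_inl` (p622903) fed by bsd-stepL's (O2′)
`exists_pow_smul_eq_zero_and_finite_of_fixed` (every `ker`-fixed 3-power torsion point of `W′(K̄)` is killed by ONE `3^k`) through
`ℚ₃ ≃+* K_𝔭′` and the open local image of `κ`. [cite: Castella2018Erratum, Lemma 2.1 and Remark (2) (p. 2)]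
[cite: SilvermanATAEC1994, Thm. V.5.3] [cite: Brink2007, Cor. 1] -/
theorem twin_cube_boundedInvariants_extendScalars (hm : Mult W' 3) (hN : W'.conductorNorm ℤ = N')
    (hK : IsImaginaryQuadratic K) (hH : SatisfiesHeegnerHypothesis N' K) (κ : ZpExtension K 3) (hκ : κ.IsAnticyclotomic)
    (D : TateParameterData W' 3)
    (𝔭' : HeightOneSpectrum (𝓞 K)) (h𝔭' : ((3 : ℕ) : 𝓞 K) ∈ 𝔭'.asIdeal)
    (𝒪 : Type) [CommRing 𝒪] [Algebra ℤ_[3] 𝒪] [Module.Free ℤ_[3] 𝒪] [TopologicalSpace 𝒪]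
    [TopologicalSpace (PowerSeries 𝒪)]
    [ContinuousSMul (PowerSeries 𝒪) (BigRepModule 𝒪 3
      (CoeffExtension ℤ_[3] 𝒪 (PrimaryTorsion (W'.baseChange K).geomPoints 3)))] :
    ∃ k : ℕ, ∀ x ∈ (((AnticyclotomicBigGaloisRep κ (ContinuousRep.extendScalars (R := ℤ_[3])
        (G := absoluteGaloisGroup K) (A := PrimaryTorsion (W'.baseChange K).geomPoints 3) 𝒪
        ((W'.baseChange K).primaryTorsionGaloisRep 3))).restrict
          (BigGaloisRep.localMap K (Sum.inl 𝔭'))).toTopRep).ρ.invariants,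
      (C (3 : 𝒪) : PowerSeries 𝒪) ^ k • x = 0 := by
  haveI : Fact (Nat.Prime 3) := ⟨Nat.prime_three⟩
  haveI : CharZero (𝔭'.adicCompletion K) :=
    charZero_of_injective_algebraMap (algebraMap K (𝔭'.adicCompletion K)).injective
  have hsplit : W'.HasSplitMultiplicativeReductionAtPrime 3 := D.split
  obtain ⟨he, hf⟩ := degreeOne_of_splitsIn hK.finrank_eq_two (twin_splitsIn_three W' N' hm hN hH) h𝔭'
  obtain ⟨φ⟩ := nonempty_padic_ringEquiv_adicCompletion 3 K 𝔭' h𝔭' he hf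
  obtain ⟨s, hsurj⟩ :=
    AnticyclotomicLocalImage.anticyclotomic_exists_forall_exists_toAdd_eq_pow_mul hK (by norm_num) κ hκ 𝔭' h𝔭'
  let f : absoluteGaloisGroup (𝔭'.adicCompletion K) →ₜ* Multiplicative ℤ_[3] :=
    κ.toContinuousMonoidHom.comp (absGaloisRestrict K (𝔭'.adicCompletion K))
  have hsurjf : ∀ y : ℤ_[3], ∃ τ : absoluteGaloisGroup (𝔭'.adicCompletion K), (f τ).toAdd = (3 : ℤ_[3]) ^ s * y :=
    hsurj
  obtain ⟨k, hk, -, -⟩ := exists_pow_smul_eq_zero_and_finite_of_fixed W' K (𝔭'.adicCompletion K) (by norm_num)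
    hsplit φ f hsurjf
  refine ⟨k, boundedInvariants_extendScalars_localMap_inl (W'.baseChange K) 𝒪 κ 𝔭' fun P hP hPj ↦ ?_⟩
  obtain ⟨j, hj⟩ := hPj
  exact hk P j hj fun τ hτ ↦ hP τ (by
    have : f τ = 1 := hτ
    simpa [f] using this)

end Summit.BirchSwinnertonDyer.BirchSwinnertonDyer.Theorems.UniversalToricDescentTwinCubeLocalInvariants

end
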